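import Literature.MathematicalPhysics.QuantumFieldTheory.Balaban1983to89.B9Thm33G0ProbeZeroAtCutPins
import Literature.MathematicalPhysics.QuantumFieldTheory.Balaban1983to89.Node00.OpsYRecordV4P
import Literature.MathematicalPhysics.QuantumFieldTheory.Balaban1983to89.Node00.Record11
import Literature.MathematicalPhysics.QuantumFieldTheory.Balaban1983to89.B9Thm312WholeDir
import Literature.MathematicalPhysics.QuantumFieldTheory.Balaban1983to89.B9Eq3132TentKinetic
import Literature.MathematicalPhysics.QuantumFieldTheory.Balaban1983to89.B9CoReadingCoordsTranspose
import Literature.MathematicalPhysics.QuantumFieldTheory.Balaban1983to89.B9CoReadingCoordsH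
import Literature.MathematicalPhysics.QuantumFieldTheory.Balaban1983to89.B9CoReadingCoordsS

/-!
# BalabanUVNodes ∕ N06 ([B9], `Dag.B9_main`) — ROWS 20–21's HÖLDER PROBE OF `G₀ = G(U)` (`Thm33G0DirX.pX0`) AT def-Y's MEMBERS OF RECORD, FROM THE G₀ LAYER'S
# `Thm33G0.e0 ∕ Thm33G0Dir.e1d` — the member-∀ knit of dag-n06-w6's `B9Thm33G0ProbeZeroAtCutPins.pX0_of_pins` at the cut bond probe carrier `holderProbesKA`

Track A of `YM-PLAN.md` (cell `pub-ymgap`, HUMAN RULING D-0062), node **N06** = [Balaban1985BackgroundPropagators] Thms 3.1–3.15; seat `pub-ymgap-dag-n06-d`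
(s2, «knit N06 at the ₁₁ record»), gen 11.  A HELPER for the stage-11 certificate editions ≥ 31.

WHAT.  Editions 24–30 display rows 20–21's probe schema `hX : … → Thm33G0DirX (𝔬12 x) (𝔭A x) (𝔡A x).Dd 1 (H x) _ (bH13 x) Bx0 BdX δ12₀ δ12₃ U`; its field `pX0 β`
— the Hölder probe `Φ_β` ([B9] (3.40) p. 397) of `G₀ = G(U)` majorised by `Bx0 β·e^{−δ₀d}` from the class `𝔠⁽⁰⁾` into the probe class `𝔠_P^{(β−2)}` — is, once the probe
family is pinned to dag-n06-w6's CUT carrier `holderProbesKA` (edition 30), their THEOREM `pX0_of_pins` (p612866: covariant taxicab telescoping + near-pair block geometry,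
no residual hypothesis) from the two G₀-layer faces `Thm33G0.e0` (sup majorant `B₀·(Lʲη)²·e^{−δ₀d}`, (3.42)) and `Thm33G0Dir.e1d` (`∇_ν G₀`: `B₀·(Lʲη)·e^{−δ₀d}`), both
DERIVED in the certificate since editions 13∕16 (`g0_layer_of_thm310_coreB`, constants `B12₀ δ12₀`, regime (M₀, a₀)).  THIS FILE states the knit ONCE, in the
certificate's member-∀ binder shape (the `hX0` input of this seat's X-split StepDirB layer `N06StepDirLayerAtPinsBCZX.stepDirB_layer_of_lettersCZX`):
★★ `hX0_of_pins` — inputs: the pins `hlev hβ1` (block map), `h𝔭A` (cut carrier at the record's taxicab transporter `(lettersYOfRecordV4P …).parB = parBY`,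
`Node00.lettersYOfRecordV4P_parB`), `hblk12`, `h𝔡Ad`; the signs `0 ≤ B12₀`, `0 ≤ δ12₀`; the two faces as ∀-families in the regime (M₀, a₀) under (3.35)∕(3.36); output:
`∀ x, M₀ ≤ M_x → ∀ α₀ > 0, M_xα₀ ≤ a₀ → ∀ U, Reg335 → Reg336 → ∀ β ∈ [0,1), HasMaj (cNormR 1 (H x) (𝔬12 x).blk _ 0) (cNormR 1 (H x) (𝔭A x).blkPX _ (β−2)) ((𝔭A x).ΦX U β ∘ₗ
(𝔬12 x).G0 U) (CX0·e^{−δ12₀d})` at the CLOSED constant `CX0 = coordBound39 b·(d+1)·basisBound39 b·B12₀·(ℓ+1)·e^{δ12₀((d+1)((ℓ+1)+1)+2)} + B12₀ + coordBound39 b·basisBound39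
b·B12₀`, `b = trBasis N`; the (3.35) class gives unitary-like bond variables (`specialUnitaryUnits_le_unitaryUnits`, `B9Eq3132TentKinetic.contractive_of_mem`); and
★ `cX0_nonneg`.  (Knit note: dag-n06-w6's theorem is applied with its implicit background NAMED, `(B := bg9Y … x)` — left implicit, the postponed
`?B.Cfg ≟ CfgY …` unification unfolds the torus partition and times out.)
HONEST FRAMING.  Kernel bookkeeping (one application of dag-n06-w6's theorem per member, configuration and exponent); COUNT-NEUTRAL; nothing of [B9] asserted —
the G₀ faces are the certificate's derived families, displayed here as hypotheses; N06 NOT discharged.  One finite 𝕋⁴ programme at fixed `ε` — NOT continuum, NOT OS,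
NOT the mass gap ∕ Clay.  0 `def`, 0 `sorry`.
-/

noncomputable section

namespace Summit.QuantumFields.YangMills.BalabanUVNodes.N06ProbeZeroAtPinsPhys

open Literature.MathematicalPhysics.QuantumFieldTheory.Balaban1983to89
open Literature.MathematicalPhysics.QuantumFieldTheory.Balaban1983to89.Node00 (FBondY IBondY BondParY lettersYOfRecordV4P lettersYOfRecordV4P_parB ResY Stage11Params)
open Literature.MathematicalPhysics.QuantumFieldTheory.Balaban1983to89.T4Continuum (T4Family)
open Literature.MathematicalPhysics.QuantumFieldTheory.Balaban1983to89.B9Thm34Ext (toB6)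
open Literature.MathematicalPhysics.QuantumFieldTheory.Balaban1983to89.B11SectG (HasMaj)
open Literature.MathematicalPhysics.QuantumFieldTheory.Balaban1983to89.B6RandomWalk (HasMajorant)
open Literature.MathematicalPhysics.QuantumFieldTheory.Balaban1983to89.B6RandomWalkHom (HasMajorantHom)
open Literature.MathematicalPhysics.QuantumFieldTheory.Balaban1983to89.B9Thm312WholeClasses (cNormR)
open Literature.MathematicalPhysics.QuantumFieldTheory.Balaban1983to89.B9RWSums343Holder (HolderProbes)
open Literature.MathematicalPhysics.QuantumFieldTheory.Balaban1983to89.B9RWSums346SecondDiff (DirOps310)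
open Literature.MathematicalPhysics.QuantumFieldTheory.Balaban1983to89.B9Thm310Whole (Ops310)
open Literature.MathematicalPhysics.QuantumFieldTheory.Balaban1983to89.B9CoReadingCoords (coordOpK XBK blkBK cdBₗ)
open Literature.MathematicalPhysics.QuantumFieldTheory.Balaban1983to89.B9CoReadingCoordsS (XSK)
open Literature.MathematicalPhysics.QuantumFieldTheory.Balaban1983to89.B9CoReadingCoordsH (XHK)
open Literature.MathematicalPhysics.QuantumFieldTheory.Balaban1983to89.B9CoReadingCoordsHolder (PK)
open Literature.MathematicalPhysics.QuantumFieldTheory.Balaban1983to89.B9CoReadingCoordsHolderAdm (holderProbesKA)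
open Literature.MathematicalPhysics.QuantumFieldTheory.Balaban1983to89.B9CoReadingCoordsTranspose (TrIdx trBasis)
open Literature.MathematicalPhysics.QuantumFieldTheory.Balaban1983to89.B9Thm39ReadingCoords (coordBound39 basisBound39)
open Literature.MathematicalPhysics.QuantumFieldTheory.Balaban1983to89.B9Thm33G0ProbeZeroAtCutPins (pX0_of_pins)
open Literature.MathematicalPhysics.QuantumFieldTheory.Balaban1983to89.B9PinMembersKLevelV1 (MemberY geo9Y bg9Y)
open Literature.MathematicalPhysics.QuantumFieldTheory.Balaban1983to89.B9GeoLemma21KLevelV1 (geo9Y_len_pos)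
open Literature.MathematicalPhysics.QuantumFieldTheory.Balaban1983to89.B9Thm312Whole (GeoOK)
open Literature.MathematicalPhysics.QuantumFieldTheory.Balaban1983to89.B9PinGeometryKLevelV1 (c35Y)
open Literature.MathematicalPhysics.QuantumFieldTheory.Balaban1983to89.B9GeoLemma21KLevelV1 (geo9Y_dist_triangle geo9Y_dist_comm)
open Literature.MathematicalPhysics.QuantumFieldTheory.Balaban1983to89.B9GeoNormsKLevelV1 (geo9K_dist_nonneg)
open Literature.MathematicalPhysics.QuantumFieldTheory.Balaban1983to89.B7Prop2SpecialUnitary (specialUnitaryUnits specialUnitaryUnits_le_unitaryUnits)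
open Literature.MathematicalPhysics.QuantumFieldTheory.Balaban1983to89.B6GlobalChartV1 (blkV1)
open Literature.MathematicalPhysics.QuantumFieldTheory.Balaban1983to89.B6Ineq2142KLevelV1 (β lvl)
open Literature.MathematicalPhysics.QuantumFieldTheory.Balaban1983to89.B6Geom246MultiLevelTorus (geomT)
open scoped Matrix.Norms.L2Operator

variable {N : ℕ} {F : T4Family}

/-- ★ the closed `pX0` constant is non-negative for `0 ≤ B₀`. [cite: Balaban1985BackgroundPropagators, (3.40)+(3.42) p.397, bookkeeping] -/
theorem cX0_nonneg (d ℓ : ℕ) {B₀ : ℝ} (hB₀ : 0 ≤ B₀) (δ₀ : ℝ) :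
    0 ≤ coordBound39 (trBasis N) * ((d : ℝ) + 1) * basisBound39 (trBasis N) * B₀ * ((ℓ : ℝ) + 1) * Real.exp (δ₀ * (((d : ℝ) + 1) * (((ℓ : ℝ) + 1) + 1) + 2)) +
      B₀ + coordBound39 (trBasis N) * basisBound39 (trBasis N) * B₀ := by
  have hcB : 0 ≤ coordBound39 (trBasis N) := by unfold coordBound39; exact norm_nonneg _
  have hbB : 0 ≤ basisBound39 (trBasis N) := Finset.sum_nonneg fun _ _ => norm_nonneg _
  positivity

/-- ★★ **`hX.pX0` AT THE MEMBERS OF RECORD FROM THE G₀ LAYER'S `e0 ∕ e1d`** (module docstring): the `hX0` input of `stepDirB_layer_of_lettersCZX` in the regime (M₀, a₀), at the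
closed constant of `cX0_nonneg`, from dag-n06-w6's `pX0_of_pins` at the cut carrier `holderProbesKA` pinned by `h𝔭A` (edition 30's text), the record's taxicab transporter
(`lettersYOfRecordV4P_parB`), the block-map pins `hlev hβ1 hblk12 h𝔡Ad` and the (3.35) class of `U`.
[cite: Balaban1985BackgroundPropagators, (3.40)+(3.42) p.397, Thm 3.3 p.399, (3.35) p.396, pp.422–423; Balaban1984PropagatorsII, (2.51) p.232] -/
theorem hX0_of_pins [NeZero N] (θ : Stage11Params F N) (Mstar : ℕ) (𝔯 : ResY N θ.toStage3Params Mstar)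
    [∀ x : MemberY θ.d₆ θ.ℓ₆ θ.hd' θ.hL' θ.b₀ θ.b₁ Mstar, Fintype (geo9Y x).Site]
    {ιA AA : MemberY θ.d₆ θ.ℓ₆ θ.hd' θ.hL' θ.b₀ θ.b₁ Mstar → Type} (H : MemberY θ.d₆ θ.ℓ₆ θ.hd' θ.hL' θ.b₀ θ.b₁ Mstar → Prop)
    (bI : ∀ x : MemberY θ.d₆ θ.ℓ₆ θ.hd' θ.hL' θ.b₀ θ.b₁ Mstar, FBondY x.toKIdx → IBondY x.toKIdx)
    (hlev : ∀ (x : MemberY θ.d₆ θ.ℓ₆ θ.hd' θ.hL' θ.b₀ θ.b₁ Mstar) (f : FBondY x.toKIdx), lvl x.hN x.D x.hk (bI x f) = (blkV1 x.hN x.D f).1.1)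
    (hβ1 : ∀ (x : MemberY θ.d₆ θ.ℓ₆ θ.hd' θ.hL' θ.b₀ θ.b₁ Mstar) (f : FBondY x.toKIdx), (geomT x.D).dist (β x.hN x.D x.hk (bI x f)) (blkV1 x.hN x.D f) ≤ 1)
    (𝔬A : ∀ x : MemberY θ.d₆ θ.ℓ₆ θ.hd' θ.hL' θ.b₀ θ.b₁ Mstar, Ops310 (geo9Y x) (bg9Y (Matrix (Fin N) (Fin N) ℂ) (specialUnitaryUnits (Fin N)) x) (XBK (TrIdx N) x.toKIdx) (XBK (TrIdx N) x.toKIdx) (ιA x) (AA x))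
    (𝔭A : ∀ x : MemberY θ.d₆ θ.ℓ₆ θ.hd' θ.hL' θ.b₀ θ.b₁ Mstar, HolderProbes (geo9Y x) (bg9Y (Matrix (Fin N) (Fin N) ℂ) (specialUnitaryUnits (Fin N)) x) (XBK (TrIdx N) x.toKIdx) (XBK (TrIdx N) x.toKIdx) (PK (FBondY x.toKIdx) (Fin (θ.d₆ + 1)) (TrIdx N)) (PK (FBondY x.toKIdx) (Fin (θ.d₆ + 1)) (TrIdx N)))
    (h𝔭A : ∀ x : MemberY θ.d₆ θ.ℓ₆ θ.hd' θ.hL' θ.b₀ θ.b₁ Mstar, 𝔭A x = holderProbesKA x.toKIdx (trBasis N) (bg9Y (Matrix (Fin N) (Fin N) ℂ) (specialUnitaryUnits (Fin N)) x) (fun U => U) (lettersYOfRecordV4P N θ.toStage3Params Mstar 𝔯 x).parB (bI x))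
    (𝔡A : ∀ x : MemberY θ.d₆ θ.ℓ₆ θ.hd' θ.hL' θ.b₀ θ.b₁ Mstar, DirOps310 (𝔬A x) (Fin (θ.d₆ + 1)))
    (h𝔡Ad : ∀ (x : MemberY θ.d₆ θ.ℓ₆ θ.hd' θ.hL' θ.b₀ θ.b₁ Mstar) (U : (bg9Y (Matrix (Fin N) (Fin N) ℂ) (specialUnitaryUnits (Fin N)) x).Cfg), (𝔡A x).Dd U = fun μ => coordOpK (trBasis N) (fun _ : Fin (θ.d₆ + 1) => cdBₗ x.toKIdx U μ))
    (𝔬12 : ∀ x : MemberY θ.d₆ θ.ℓ₆ θ.hd' θ.hL' θ.b₀ θ.b₁ Mstar, B9Thm312Whole.Ops (geo9Y x) (bg9Y (Matrix (Fin N) (Fin N) ℂ) (specialUnitaryUnits (Fin N)) x) (XBK (TrIdx N) x.toKIdx) (XBK (TrIdx N) x.toKIdx) (XHK (TrIdx N) x.toKIdx) (XSK (TrIdx N) x.toKIdx))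
    (hblk12 : ∀ x : MemberY θ.d₆ θ.ℓ₆ θ.hd' θ.hL' θ.b₀ θ.b₁ Mstar, (𝔬12 x).blk = blkBK x.toKIdx (bI x))
    {B12₀ δ12₀ M₀ a₀ : ℝ} (hB12₀ : 0 ≤ B12₀) (hδ12₀ : 0 ≤ δ12₀)
    (he0 : ∀ x : MemberY θ.d₆ θ.ℓ₆ θ.hd' θ.hL' θ.b₀ θ.b₁ Mstar, M₀ ≤ (geo9Y x).M → ∀ α₀ : ℝ, 0 < α₀ → (geo9Y x).M * α₀ ≤ a₀ → ∀ U : (bg9Y (Matrix (Fin N) (Fin N) ℂ) (specialUnitaryUnits (Fin N)) x).Cfg, (bg9Y (Matrix (Fin N) (Fin N) ℂ) (specialUnitaryUnits (Fin N)) x).Reg335 c35Y α₀ U →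
      (bg9Y (Matrix (Fin N) (Fin N) ℂ) (specialUnitaryUnits (Fin N)) x).Reg336 c35Y α₀ U → HasMajorant (g := toB6 (geo9Y x) 1 (H x)) (𝔬12 x).blk ((𝔬12 x).G0 U) (fun (a b : (geo9Y x).Site) => B12₀ * (geo9Y x).len a ^ 2 * Real.exp (-(δ12₀ * (geo9Y x).dist a b))))
    (he1d : ∀ x : MemberY θ.d₆ θ.ℓ₆ θ.hd' θ.hL' θ.b₀ θ.b₁ Mstar, M₀ ≤ (geo9Y x).M → ∀ α₀ : ℝ, 0 < α₀ → (geo9Y x).M * α₀ ≤ a₀ → ∀ U : (bg9Y (Matrix (Fin N) (Fin N) ℂ) (specialUnitaryUnits (Fin N)) x).Cfg, (bg9Y (Matrix (Fin N) (Fin N) ℂ) (specialUnitaryUnits (Fin N)) x).Reg335 c35Y α₀ U →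
      (bg9Y (Matrix (Fin N) (Fin N) ℂ) (specialUnitaryUnits (Fin N)) x).Reg336 c35Y α₀ U → ∀ ν : Fin (θ.d₆ + 1), HasMajorantHom (g := toB6 (geo9Y x) 1 (H x)) (𝔬12 x).blk (𝔬12 x).blk ((𝔡A x).Dd U ν ∘ₗ (𝔬12 x).G0 U) (fun (a b : (geo9Y x).Site) => B12₀ * (geo9Y x).len a * Real.exp (-(δ12₀ * (geo9Y x).dist a b)))) :
    ∀ x : MemberY θ.d₆ θ.ℓ₆ θ.hd' θ.hL' θ.b₀ θ.b₁ Mstar, M₀ ≤ (geo9Y x).M → ∀ α₀ : ℝ, 0 < α₀ → (geo9Y x).M * α₀ ≤ a₀ → ∀ U : (bg9Y (Matrix (Fin N) (Fin N) ℂ) (specialUnitaryUnits (Fin N)) x).Cfg, (bg9Y (Matrix (Fin N) (Fin N) ℂ) (specialUnitaryUnits (Fin N)) x).Reg335 c35Y α₀ U →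
      (bg9Y (Matrix (Fin N) (Fin N) ℂ) (specialUnitaryUnits (Fin N)) x).Reg336 c35Y α₀ U → ∀ β : ℝ, 0 ≤ β → β < 1 →
        HasMaj (cNormR 1 (H x) (𝔬12 x).blk (fun y => (geo9Y_len_pos x y).le) 0) (cNormR 1 (H x) (𝔭A x).blkPX (fun y => (geo9Y_len_pos x y).le) (β - 2))
          ((𝔭A x).ΦX U β ∘ₗ (𝔬12 x).G0 U) (fun a b => (coordBound39 (trBasis N) * ((θ.d₆ : ℝ) + 1) * basisBound39 (trBasis N) * B12₀ * ((θ.ℓ₆ : ℝ) + 1) * Real.exp (δ12₀ * (((θ.d₆ : ℝ) + 1) * (((θ.ℓ₆ : ℝ) + 1) + 1) + 2)) +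
            B12₀ + coordBound39 (trBasis N) * basisBound39 (trBasis N) * B12₀) * Real.exp (-(δ12₀ * (geo9Y x).dist a b))) := fun x hM α₀ hα ha U hU hU' βh _ hb1 => by
  letI : Fintype (B9GeoNormsKLevelV1.geo9K x.toKIdx).Site := (inferInstance : Fintype (geo9Y x).Site)
  have hUL : ∀ μ z, T4RelativeLadder.UnitaryLike (U μ z) := fun μ z => B9Eq3132TentKinetic.contractive_of_mem (specialUnitaryUnits_le_unitaryUnits (hU.1.1 μ z))
  exact pX0_of_pins (B := bg9Y (Matrix (Fin N) (Fin N) ℂ) (specialUnitaryUnits (Fin N)) x) x.toKIdx (trBasis N) (⟨geo9Y_dist_triangle x, geo9Y_dist_comm x, geo9K_dist_nonneg x.toKIdx, geo9Y_len_pos x⟩ : GeoOK (geo9Y x)) (fun U => U) (lettersYOfRecordV4P_parB N θ.toStage3Params Mstar 𝔯 x) U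
    hUL (hlev x) (hβ1 x) (h𝔭A x) (hblk12 x) (h𝔡Ad x U)
    (fun y => (geo9Y_len_pos x y).le) ((𝔬12 x).G0 U) hB12₀ hδ12₀ (he0 x hM α₀ hα ha U hU hU') (he1d x hM α₀ hα ha U hU hU') hb1.le

end Summit.QuantumFields.YangMills.BalabanUVNodes.N06ProbeZeroAtPinsPhys

end
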